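import Literature.Analysis.FluidPDE.BackwardEnergyUniqueness
import HarnessLib

/-!
# Backward uniqueness of classical Navier–Stokes flows on `ℝ³` with decay margin `r > 3` and a
# bounded pressure difference (Temam 1997, Ch. III §6; Bardos–Tartar 1973)

Analysis/FluidPDE proof file (theorems only: no definition, no named fact), the third member of
the family `BackwardEnergyUniqueness.lean` (uniform rapid decay of both flows) /
`BackwardEnergyUniquenessFiniteDecay.lean` (six uniform bounds `≤ C(1 + |x|)^{-r}` on the
difference, `r > 4`, no hypothesis on the pressure). Source: R. Temam, *Infinite-Dimensional
Dynamical Systems in Mechanics and Physics*, 2nd ed. 1997, Ch. III §6, Lemma 6.1 (6.9)–(6.11),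
Lemma 6.2 (6.12)–(6.14), §6.2 (6.16)–(6.17) (pp. 172–175); the log-convexity method of
Bardos–Tartar 1973 and Ghidaglia 1986 (Remark 6.1 there).

## Why a third rendering

In the whole-space classical rendering the only place where the decay margin `r > 4 = dim + 1`
is needed is the vanishing of the pressure pairings `∫⟪∇q, w⟫ = ∫⟪∇q, Δw⟫ = 0`: the equation
bounds `∇q`, so `q` may grow linearly, and `q·w`, `q·∇w` are integrable only for `r > dim + 1`
(`integral_inner_gradient_eq_zero`, Majda–Bertozzi's frame). A genuine Navier–Stokes flow issued
from rapidly decaying data has, generically, a velocity profile that "cannot decay faster than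
`O(|x|^{-4})`" at positive times (instantaneous spreading: Dobrokhotov–Shafarevich, Brandolese;
Lemarié-Rieusset 2016, §4.9, Thm. 4.10, PDF p. 90), so `r > 4` just fails for a difference of two
such flows — while the physical pressure `p = Σ RᵢRⱼ(uᵢuⱼ) ~ |x|^{-3}` is BOUNDED. With a bounded pressure (difference) the
pairings vanish as soon as `q·w`, `q·∇w`, `w·∇q` are integrable, i.e. for `r > 3 = dim`
(`integral_inner_gradient_eq_zero_of_bounded`, from the tree's integrability-based
`integral_inner_gradient_eq_zero_of_isDivFree_R3`). Everything else in Temam's two fixed-time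
computations already works for `r > 3`. Hence this file: the fixed-time lemmas
(`two_integral_inner_timeDeriv_eq_of_boundedPressure`,
`neg_two_integral_inner_timeDeriv_le_of_boundedPressure`,
`dirichletQuotient_ineq_of_boundedPressure`) are the tree's
`two_integral_inner_timeDeriv_eq` / `neg_two_integral_inner_timeDeriv_le` /
`dirichletQuotient_ineq` VERBATIM with `r > 4` traded for `r > 3` plus `|q| ≤ C_q`, and the
assembly and the Navier–Stokes corollaries follow `BackwardEnergyUniquenessFiniteDecay.lean`:

* `eq_zero_of_perturbedStokes_backward_of_boundedPressure` — Lemma 6.2 for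
  `∂ₜw = νΔw − ∇q + f`, `‖f‖ ≤ a‖∇w‖ + b‖w‖`, `div w = 0`, six uniform bounds with `r > 3`,
  `q(t)` bounded on each slice `t ∈ (0, T)` (the bound may depend on `t`: only fixed-time
  integrability is used, so the statement is invariant under `q ↦ q + c(t)`);
* `linearisedNS_backward_unique_of_boundedPressure` — `f = −(U₁·∇)w − (w·∇)U₂`;
* `IsClassicalNSSolutionOn.backward_unique_of_boundedPressure` (and `…_symm`) — two classical
  flows, same `ν > 0` and force, `‖u₁‖ ≤ A`, `‖∇u₂‖ ≤ B` on the open slab, pressure difference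
  bounded on each slice, velocity difference obeying the six bounds with `r > 3`, equal at `T`
  ⟹ equal on `[0, T]`.

Honest scope: the bounds are required on the CLOSED slab (continuity of the energy at the end
points); `r > 3` is what makes `|w|²`, `|∇w|²`, … and the pressure pairings absolutely
integrable with the tree's product lemmas; the abstract Hilbert-space statement (no decay
bookkeeping at all, only `L²`-level data) is
`Literature.Analysis.ODE.eq_zero_of_abstractParabolic_backward`.

## Mathlib / tree search

Reused by name: `integral_inner_gradient_eq_zero_of_isDivFree_R3` (`EnstrophyGronwall.lean`),
`integrable_of_norm_le_const_mul_decay`, `integrable_of_norm_le_decay_mul_decay`,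
`integral_inner_laplacian_self_eq_neg_gradNormSq`, `decay_le_const`
(`EnergyUniqueness.lean`), `integral_sum_inner_fderiv_fderiv_eq_neg_integral_inner_laplacian`
(`EnstrophyGronwall.lean`), `isDivFree_laplacian_of_contDiff_three`, `norm_fderiv_laplacian_sq_le`,
`LogConvexity.eq_zero_of_backward` (`BackwardEnergyUniqueness.lean`). The private helpers of
`BackwardEnergyUniqueness.lean` (`finrank_euclideanSpace_fin_three_real`,
`frobeniusNormSq_le_three_mul_sq`, `norm_laplacian_le_three`, `LogConvexity.young_aux`,
`LogConvexity.quotient_aux`) are private there and re-proved here verbatim (primed names).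
`lean search 'boundedPressure|gradient_eq_zero_of_bounded'`: nothing (2026-08-27).

## References

* R. Temam, *Infinite-Dimensional Dynamical Systems in Mechanics and Physics*, 2nd ed.,
  Springer 1997, Ch. III §6: Lemma 6.1, Lemma 6.2, Remark 6.1, §6.2 (pp. 171–175). [Temam1997]
* C. Bardos, L. Tartar, *Sur l'unicité rétrograde des équations paraboliques et quelques
  questions voisines*, Arch. Rational Mech. Anal. 50 (1973) 10–25. [BardosTartar1973]
* A. J. Majda, A. L. Bertozzi, *Vorticity and Incompressible Flow*, CUP 2002, §3.1.1
  (the decay frame; pressure term p. 87). [MajdaBertozziCUP2002]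
* P. G. Lemarié-Rieusset, *The Navier–Stokes Problem in the 21st Century*, CRC Press 2016,
  §4.9 Thm. 4.10 (instantaneous spreading, the `O(|x|^{-4})` obstruction). [LemarieRieusset2016]
-/

noncomputable section

open MeasureTheory Set Function Filter Metric
open _root_.Topology
open scoped RealInnerProductSpace NNReal ENNReal ContDiff

namespace Literature.Analysis.FluidPDE

/-! ### §1. The pressure term drops: bounded pressure, decay margin `r > dim` -/

section Pressure

open InnerProductSpace

/-- **The pressure term drops out, bounded-pressure form** (Majda–Bertozzi, §3.1.1, p. 87:
"`−(∇p̃, ṽ) = (p̃, div ṽ) = 0` because `ṽ` is divergence free"): for a `C¹` divergence-free field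
`w` on `ℝ³` decaying with its derivative like `(1 + ‖x‖)^{-r}`, `3 < r`, and a `C¹` scalar `q`
which is BOUNDED with bounded gradient, `∫ ⟪∇q, w⟫ = 0`. (The three products `wᵢ∂ᵢq`,
`∂ᵢwᵢ q`, `wᵢ q` are then absolutely integrable and the tree's coordinatewise integration by
parts `integral_inner_gradient_eq_zero_of_isDivFree_R3` applies; compare
`integral_inner_gradient_eq_zero`, which allows linear growth of `q` at the price `r > 4`.)
[cite: MajdaBertozziCUP2002, §3.1.1 p. 87 (pressure term)] -/
theorem integral_inner_gradient_eq_zero_of_bounded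
    {w : EuclideanSpace ℝ (Fin 3) → EuclideanSpace ℝ (Fin 3)} {q : EuclideanSpace ℝ (Fin 3) → ℝ}
    (hw1 : ContDiff ℝ 1 w) (hq1 : ContDiff ℝ 1 q) (hdiv : VectorCalculus.IsDivFree w)
    {Cw Cq Cq' r : ℝ} (hr : (Module.finrank ℝ (EuclideanSpace ℝ (Fin 3)) : ℝ) < r)
    (hw : ∀ x, ‖w x‖ ≤ Cw * (1 + ‖x‖) ^ (-r)) (hDw : ∀ x, ‖fderiv ℝ w x‖ ≤ Cw * (1 + ‖x‖) ^ (-r))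
    (hqb : ∀ x, ‖q x‖ ≤ Cq) (hDq : ∀ x, ‖gradient q x‖ ≤ Cq') :
    ∫ x, ⟪gradient q x, w x⟫ = 0 := by
  set e := EuclideanSpace.basisFun (Fin 3) ℝ with he
  have he1 : ∀ i, ‖e i‖ = 1 := fun i => e.orthonormal.1 i
  have hwc : Continuous w := hw1.continuous
  have hDwc : Continuous (fderiv ℝ w) := hw1.continuous_fderiv one_ne_zero
  have hqc : Continuous q := hq1.continuous
  have hDqc : Continuous (fderiv ℝ q) := hq1.continuous_fderiv one_ne_zero
  have hDq' : ∀ x, ‖fderiv ℝ q x‖ ≤ Cq' := fun x => by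
    have h := hDq x
    rwa [gradient, LinearIsometryEquiv.norm_map] at h
  have hwi : ∀ i x, ‖⟪e i, w x⟫‖ ≤ ‖w x‖ := fun i x => by
    rw [Real.norm_eq_abs]
    exact (abs_real_inner_le_norm _ _).trans_eq (by rw [he1, one_mul])
  have hDwi : ∀ i x, ‖⟪e i, fderiv ℝ w x (e i)⟫‖ ≤ ‖fderiv ℝ w x‖ := fun i x => by
    rw [Real.norm_eq_abs]
    refine (abs_real_inner_le_norm _ _).trans ?_
    rw [he1, one_mul]
    exact (ContinuousLinearMap.le_opNorm _ _).trans_eq (by rw [he1, mul_one])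
  have hDqi : ∀ i x, ‖fderiv ℝ q x (e i)‖ ≤ Cq' := fun i x =>
    ((ContinuousLinearMap.le_opNorm _ _).trans_eq (by rw [he1, mul_one])).trans (hDq' x)
  have hCq : 0 ≤ Cq := (norm_nonneg _).trans (hqb 0)
  have hCq' : 0 ≤ Cq' := (norm_nonneg _).trans (hDq 0)
  refine integral_inner_gradient_eq_zero_of_isDivFree_R3 hq1 hw1 hdiv (fun i => ?_) (fun i => ?_)
    (fun i => ?_)
  · refine integrable_of_norm_le_const_mul_decay (C₁ := Cq') (C₂ := Cw) (r := r)
      ((continuous_const.inner hwc).mul (hDqc.clm_apply continuous_const)) hr fun x => ?_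
    rw [norm_mul, mul_comm]
    exact mul_le_mul (hDqi i x) ((hwi i x).trans (hw x)) (norm_nonneg _) hCq'
  · refine integrable_of_norm_le_const_mul_decay (C₁ := Cq) (C₂ := Cw) (r := r)
      ((continuous_const.inner (hDwc.clm_apply continuous_const)).mul hqc) hr fun x => ?_
    rw [norm_mul, mul_comm]
    exact mul_le_mul (hqb x) ((hDwi i x).trans (hDw x)) (norm_nonneg _) hCq
  · refine integrable_of_norm_le_const_mul_decay (C₁ := Cq) (C₂ := Cw) (r := r)
      ((continuous_const.inner hwc).mul hqc) hr fun x => ?_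
    rw [norm_mul, mul_comm]
    exact mul_le_mul (hqb x) ((hwi i x).trans (hw x)) (norm_nonneg _) hCq

end Pressure

/-! ### §2. The two fixed-time computations on `ℝ³`, bounded-pressure form (`r > 3`) -/

section FixedTime

open InnerProductSpace
open scoped Laplacian

variable {w w' f : EuclideanSpace ℝ (Fin 3) → EuclideanSpace ℝ (Fin 3)}
  {q : EuclideanSpace ℝ (Fin 3) → ℝ} {ν a b C r Cq : ℝ}

/-- `dim ℝ³ = 3` as a real number (bookkeeping for the decay exponents). [folklore] -/
private theorem finrank_euclideanSpace_fin_three_real' :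
    (Module.finrank ℝ (EuclideanSpace ℝ (Fin 3)) : ℝ) = 3 := by
  rw [finrank_euclideanSpace_fin]; norm_num

/-- `‖L‖² ≤ |L|²_F` and `|L|²_F ≤ 3‖L‖²` for a linear map on `ℝ³` (operator norm versus
Frobenius norm). [folklore] -/
private theorem frobeniusNormSq_le_three_mul_sq'
    (L : EuclideanSpace ℝ (Fin 3) →L[ℝ] EuclideanSpace ℝ (Fin 3)) :
    frobeniusNormSq L ≤ 3 * ‖L‖ ^ 2 := by
  rw [frobeniusNormSq_eq_sum (EuclideanSpace.basisFun (Fin 3) ℝ)]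
  have h : ∀ i, ‖L (EuclideanSpace.basisFun (Fin 3) ℝ i)‖ ^ 2 ≤ ‖L‖ ^ 2 := fun i => by
    refine pow_le_pow_left₀ (norm_nonneg _) ?_ 2
    calc ‖L (EuclideanSpace.basisFun (Fin 3) ℝ i)‖
        ≤ ‖L‖ * ‖EuclideanSpace.basisFun (Fin 3) ℝ i‖ := L.le_opNorm _
      _ = ‖L‖ := by simp
  calc ∑ i, ‖L (EuclideanSpace.basisFun (Fin 3) ℝ i)‖ ^ 2 ≤ ∑ _i : Fin 3, ‖L‖ ^ 2 :=
        Finset.sum_le_sum fun i _ => h i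
    _ = 3 * ‖L‖ ^ 2 := by simp

/-- `‖Δw(x)‖ ≤ 3 ‖D²w(x)‖` on `ℝ³` (`norm_laplacian_le` with `dim = 3`). [folklore] -/
private theorem norm_laplacian_le_three' (w : EuclideanSpace ℝ (Fin 3) → EuclideanSpace ℝ (Fin 3))
    (x : EuclideanSpace ℝ (Fin 3)) : ‖(Δ w) x‖ ≤ 3 * ‖fderiv ℝ (fderiv ℝ w) x‖ := by
  have h := norm_laplacian_le w x
  rwa [finrank_euclideanSpace_fin_three_real'] at h

/-- Real arithmetic of the Young-inequality step in Lemma 6.1: with `g = |Δw + l w|`,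
`F = |f| ≤ aD + bW`, `D² ≤ Ff`, `−2S ≤ 2gF` one has `−2Sν ≤ 2ν²g² + a²Ff + b²W²`. [folklore] -/
private theorem LogConvexity.young_aux' {ν l a b N R W D Ff S g F : ℝ} (hν : 0 < ν)
    (hF0 : 0 ≤ F) (hg : g ^ 2 = N ^ 2 + 2 * l * R + l ^ 2 * W ^ 2) (hS : -(2 * S) ≤ 2 * (g * F))
    (hDF : D ^ 2 ≤ Ff) (hF : F ≤ a * D + b * W) :
    -(2 * S) * ν ≤ 2 * ν ^ 2 * (N ^ 2 + 2 * l * R + l ^ 2 * W ^ 2) + (a ^ 2 * Ff + b ^ 2 * W ^ 2) := by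
  rw [← hg]
  have h1 : -(2 * S) * ν ≤ 2 * (g * F) * ν := mul_le_mul_of_nonneg_right hS hν.le
  have h2 : 4 * ν * (g * F) ≤ 4 * ν ^ 2 * g ^ 2 + F ^ 2 := by
    nlinarith [sq_nonneg (2 * ν * g - F)]
  have h3 : F ^ 2 ≤ 2 * a ^ 2 * D ^ 2 + 2 * b ^ 2 * W ^ 2 := by
    have h4 : 0 ≤ a * D + b * W := hF0.trans hF
    nlinarith [sq_nonneg (a * D - b * W), mul_le_mul hF hF hF0 h4]
  have h5 : a ^ 2 * D ^ 2 ≤ a ^ 2 * Ff := mul_le_mul_of_nonneg_left hDF (sq_nonneg a)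
  linarith

/-- Real arithmetic of Lemma 6.1 at the Dirichlet quotient `l = G/E` (`E > 0`): from
`ν(ψ − lφ) ≤ a²G + b²E − 2ν²l(G − lE)` (whose last term vanishes at `l = G/E`) we get
`ψE − Gφ ≤ K(G + E)E` with `K = 2ν + a + 2b + (a² + b²)/ν + 1`. [folklore] -/
private theorem LogConvexity.quotient_aux' {ν a b ψ φ G E : ℝ} (hν : 0 < ν) (hE : 0 < E) (hG : 0 ≤ G)
    (ha : 0 ≤ a) (hb : 0 ≤ b)
    (h : ν * (ψ - G / E * φ) ≤
      a ^ 2 * G + b ^ 2 * E - 2 * ν ^ 2 * (G / E) * (G - G / E * E)) :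
    ψ * E - G * φ ≤ (2 * ν + a + 2 * b + (a ^ 2 + b ^ 2) / ν + 1) * (G + E) * E := by
  have hl : G - G / E * E = 0 := by rw [div_mul_cancel₀ G hE.ne']; ring
  rw [hl, mul_zero, sub_zero] at h
  have hψl : (ψ - G / E * φ) * E = ψ * E - G * φ := by
    rw [sub_mul, div_mul_eq_mul_div, div_mul_cancel₀ _ hE.ne']
  rw [← hψl]
  have hstep : ψ - G / E * φ ≤ (a ^ 2 * G + b ^ 2 * E) / ν := by
    rw [le_div_iff₀ hν]; linarith
  have hnum : a ^ 2 * G + b ^ 2 * E ≤ (a ^ 2 + b ^ 2) * (G + E) := by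
    nlinarith [mul_nonneg (sq_nonneg b) hG, mul_nonneg (sq_nonneg a) hE.le]
  have hKc1 : (a ^ 2 * G + b ^ 2 * E) / ν ≤
      (2 * ν + a + 2 * b + (a ^ 2 + b ^ 2) / ν + 1) * (G + E) :=
    calc (a ^ 2 * G + b ^ 2 * E) / ν ≤ (a ^ 2 + b ^ 2) * (G + E) / ν :=
          div_le_div_of_nonneg_right hnum hν.le
      _ = (a ^ 2 + b ^ 2) / ν * (G + E) := by ring
      _ ≤ (2 * ν + a + 2 * b + (a ^ 2 + b ^ 2) / ν + 1) * (G + E) := by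
          have h0 : 0 ≤ (2 * ν + a + 2 * b + 1) * (G + E) := by positivity
          linarith
  exact mul_le_mul_of_nonneg_right (hstep.trans hKc1) hE.le

/-- **The energy identity for the perturbed Stokes structure, bounded-pressure form** (Temam
1997, (6.14), first line: `−½ d/dt |w|² = −(w', w) = −(h − Aw, w)`): for a `C²` divergence-free
field `w` on `ℝ³` decaying with `∇w, ∇²w, w'` like `(1 + |x|)^{-r}`, `r > 3`, a BOUNDED `C¹`
scalar `q`, and `w' = νΔw − ∇q + f`, `∫ 2⟪w, w'⟫ = −2ν ‖∇w‖₂² + 2∫⟪w, f⟫` — the pressure term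
drops (`div w = 0`, `q` bounded, `∇q` bounded by the equation itself). Verbatim
`two_integral_inner_timeDeriv_eq` of `BackwardEnergyUniqueness.lean` with its decay margin
`r > 4` (needed there for a pressure of linear growth) traded for `r > 3` plus `|q| ≤ C_q`.
[cite: Temam1997, Ch. III §6, (6.14) (p. 173) with §6.2 (6.16)] -/
theorem two_integral_inner_timeDeriv_eq_of_boundedPressure (hw : ContDiff ℝ 2 w)
    (hw'c : Continuous w')
    (hq : ContDiff ℝ 1 q) (hqb : ∀ x, ‖q x‖ ≤ Cq) (hdiv : VectorCalculus.IsDivFree w)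
    (heq : ∀ x, w' x = ν • (Δ w) x - gradient q x + f x)
    (hf : ∀ x, ‖f x‖ ≤ a * ‖fderiv ℝ w x‖ + b * ‖w x‖) (hC : 0 ≤ C) (hr : 3 < r)
    (h0 : ∀ x, ‖w x‖ ≤ C * (1 + ‖x‖) ^ (-r)) (h1 : ∀ x, ‖fderiv ℝ w x‖ ≤ C * (1 + ‖x‖) ^ (-r))
    (h2 : ∀ x, ‖fderiv ℝ (fderiv ℝ w) x‖ ≤ C * (1 + ‖x‖) ^ (-r))
    (ht : ∀ x, ‖w' x‖ ≤ C * (1 + ‖x‖) ^ (-r)) :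
    Integrable (fun x => ⟪w x, f x⟫) ∧
    ∫ x, 2 * ⟪w x, w' x⟫ = -(2 * ν) * VectorCalculus.gradNormSq w + 2 * ∫ x, ⟪w x, f x⟫ := by
  have hr3 : (Module.finrank ℝ (EuclideanSpace ℝ (Fin 3)) : ℝ) < r := by
    rw [finrank_euclideanSpace_fin_three_real']; linarith
  have hr0 : 0 ≤ r := by linarith
  have hw1 : ContDiff ℝ 1 w := hw.of_le one_le_two
  have hwc : Continuous w := hw.continuous
  have hDwc : Continuous (fderiv ℝ w) := hw.continuous_fderiv two_ne_zero
  -- `f` is continuous (it is `w' − νΔw + ∇q`)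
  have hfeq : f = fun x => w' x - ν • (Δ w) x + gradient q x := by
    funext x; rw [heq x]; abel
  have hfc : Continuous f := by
    rw [hfeq]
    exact (hw'c.sub ((continuous_laplacian hw).const_smul ν)).add (continuous_gradient_of_contDiff hq)
  -- pointwise sizes
  have hab : ∀ x, ‖f x‖ ≤ (|a| * C + |b| * C) * (1 + ‖x‖) ^ (-r) := by
    intro x
    have hw0 : 0 ≤ (1 + ‖x‖) ^ (-r) := Real.rpow_nonneg (by positivity) _
    calc ‖f x‖ ≤ a * ‖fderiv ℝ w x‖ + b * ‖w x‖ := hf x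
      _ ≤ |a| * ‖fderiv ℝ w x‖ + |b| * ‖w x‖ := by
          gcongr <;> exact le_abs_self _
      _ ≤ |a| * (C * (1 + ‖x‖) ^ (-r)) + |b| * (C * (1 + ‖x‖) ^ (-r)) := by
          gcongr
          · exact h1 x
          · exact h0 x
      _ = (|a| * C + |b| * C) * (1 + ‖x‖) ^ (-r) := by ring
  -- the Laplacian decays (constant `3C`); the pressure gradient is bounded
  have habC : 0 ≤ |a| * C + |b| * C := by positivity
  have h3C : 0 ≤ 3 * C := by positivity
  have hΔ0 : ∀ x, ‖(Δ w) x‖ ≤ 3 * C * (1 + ‖x‖) ^ (-r) := fun x =>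
    (norm_laplacian_le_three' w x).trans (by rw [mul_assoc]; exact mul_le_mul_of_nonneg_left (h2 x) (by norm_num))
  have hgradq : ∀ x, ‖gradient q x‖ ≤ |ν| * (3 * C) + (|a| * C + |b| * C) + C := by
    intro x
    have e : gradient q x = ν • (Δ w) x + f x - w' x := by rw [heq x]; abel
    rw [e]
    have i1 : ‖ν • (Δ w) x‖ ≤ |ν| * (3 * C) := by
      rw [norm_smul, Real.norm_eq_abs]
      exact mul_le_mul_of_nonneg_left ((hΔ0 x).trans (decay_le_const x h3C hr0)) (abs_nonneg ν)
    have i2 : ‖f x‖ ≤ |a| * C + |b| * C := (hab x).trans (decay_le_const x habC hr0)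
    have i3 : ‖w' x‖ ≤ C := (ht x).trans (decay_le_const x hC hr0)
    have i4 := norm_add_le (ν • (Δ w) x) (f x)
    have i5 := norm_sub_le (ν • (Δ w) x + f x) (w' x)
    linarith
  -- integrability of the three pairings
  have hIΔ : Integrable (fun x => ⟪(Δ w) x, w x⟫) := by
    refine integrable_of_norm_le_decay_mul_decay (C₁ := 3 * C) (C₂ := C) (r := r) (r' := r)
      ((continuous_laplacian hw).inner hwc) hr3 hr0 h3C hC
      fun x => (norm_inner_le_norm _ _).trans ?_
    exact mul_le_mul (hΔ0 x) (h0 x) (norm_nonneg _) (by positivity)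
  have hIq : Integrable (fun x => ⟪gradient q x, w x⟫) := by
    refine integrable_of_norm_le_const_mul_decay (C₁ := |ν| * (3 * C) + (|a| * C + |b| * C) + C)
      (C₂ := C) (r := r) ((continuous_gradient_of_contDiff hq).inner hwc) hr3
      fun x => (norm_inner_le_norm _ _).trans ?_
    exact mul_le_mul (hgradq x) (h0 x) (norm_nonneg _) ((norm_nonneg _).trans (hgradq x))
  have hIf : Integrable (fun x => ⟪w x, f x⟫) := by
    refine integrable_of_norm_le_decay_mul_decay (C₁ := C) (C₂ := |a| * C + |b| * C) (r := r)
      (r' := r) (hwc.inner hfc) hr3 hr0 hC (by positivity)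
      fun x => (norm_inner_le_norm _ _).trans ?_
    exact mul_le_mul (h0 x) (hab x) (norm_nonneg _) (by positivity)
  -- the two whole-space integrations by parts
  have hA1 : ∫ x, ⟪(Δ w) x, w x⟫ = -VectorCalculus.gradNormSq w :=
    integral_inner_laplacian_self_eq_neg_gradNormSq hw hC hr3 h0 h1 h2
  have hA2 : ∫ x, ⟪gradient q x, w x⟫ = 0 :=
    integral_inner_gradient_eq_zero_of_bounded hw1 hq hdiv hr3 h0 h1 hqb hgradq
  -- split the pairing
  have hpw : ∀ x, 2 * ⟪w x, w' x⟫ =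
      2 * ν * ⟪(Δ w) x, w x⟫ - 2 * ⟪gradient q x, w x⟫ + 2 * ⟪w x, f x⟫ := by
    intro x
    have hc1 : ⟪w x, w' x⟫ = ⟪w' x, w x⟫ := real_inner_comm _ _
    have hc2 : ⟪f x, w x⟫ = ⟪w x, f x⟫ := real_inner_comm _ _
    rw [hc1, heq x, inner_add_left, inner_sub_left, real_inner_smul_left, hc2]
    ring
  refine ⟨hIf, ?_⟩
  simp_rw [hpw]
  have hI1 : Integrable (fun x => 2 * ν * ⟪(Δ w) x, w x⟫ - 2 * ⟪gradient q x, w x⟫) :=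
    (hIΔ.const_mul (2 * ν)).sub (hIq.const_mul 2)
  have hI2 : Integrable (fun x => 2 * ⟪w x, f x⟫) := hIf.const_mul 2
  rw [integral_add hI1 hI2, integral_sub (hIΔ.const_mul (2 * ν)) (hIq.const_mul 2),
    integral_const_mul, integral_const_mul, integral_const_mul, hA1, hA2]
  ring

/-- **Temam's (6.14) on `ℝ³` (bounded-pressure form): the energy is log-Lipschitz from below.**
Under the hypotheses of `two_integral_inner_timeDeriv_eq_of_boundedPressure` with `a ≥ 0`:
`−∫ 2⟪w, w'⟫ ≤ (2ν + a)‖∇w‖₂² + (a + 2b)‖w‖₂²`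
(printed: `d/dt log(1/|w|) = Λ − (h,w)/|w|² ≤ Λ + kΛ^{1/2}`; here `|(f, w)| ≤ a|∇w||w| + b|w|²`
and `2a|∇w||w| ≤ a(|∇w|² + |w|²)`, the operator norm of `∇w(x)` being at most its Frobenius
norm). [cite: Temam1997, Ch. III §6, Lemma 6.2, (6.14) (p. 173)] -/
theorem neg_two_integral_inner_timeDeriv_le_of_boundedPressure (ha : 0 ≤ a)
    (hw : ContDiff ℝ 2 w) (hw'c : Continuous w')
    (hq : ContDiff ℝ 1 q) (hqb : ∀ x, ‖q x‖ ≤ Cq) (hdiv : VectorCalculus.IsDivFree w)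
    (heq : ∀ x, w' x = ν • (Δ w) x - gradient q x + f x)
    (hf : ∀ x, ‖f x‖ ≤ a * ‖fderiv ℝ w x‖ + b * ‖w x‖) (hC : 0 ≤ C) (hr : 3 < r)
    (h0 : ∀ x, ‖w x‖ ≤ C * (1 + ‖x‖) ^ (-r)) (h1 : ∀ x, ‖fderiv ℝ w x‖ ≤ C * (1 + ‖x‖) ^ (-r))
    (h2 : ∀ x, ‖fderiv ℝ (fderiv ℝ w) x‖ ≤ C * (1 + ‖x‖) ^ (-r))
    (ht : ∀ x, ‖w' x‖ ≤ C * (1 + ‖x‖) ^ (-r)) :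
    -∫ x, 2 * ⟪w x, w' x⟫ ≤
      (2 * ν + a) * VectorCalculus.gradNormSq w + (a + 2 * b) * ∫ x, ‖w x‖ ^ 2 := by
  have hr3 : (Module.finrank ℝ (EuclideanSpace ℝ (Fin 3)) : ℝ) < r := by
    rw [finrank_euclideanSpace_fin_three_real']; linarith
  have hr0 : 0 ≤ r := by linarith
  obtain ⟨hIf, hid⟩ :=
    two_integral_inner_timeDeriv_eq_of_boundedPressure hw hw'c hq hqb hdiv heq hf hC hr h0 h1 h2 ht
  have hwc : Continuous w := hw.continuous
  have hw1 : ContDiff ℝ 1 w := hw.of_le one_le_two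
  -- integrability of `‖w‖²` and of the Frobenius density
  have hIe : Integrable (fun x => ‖w x‖ ^ 2) := by
    refine integrable_of_norm_le_decay_mul_decay (C₁ := C) (C₂ := C) (r := r) (r' := r)
      ((hwc.norm).pow 2) hr3 hr0 hC hC fun x => ?_
    rw [norm_pow, norm_norm, sq]
    exact mul_le_mul (h0 x) (h0 x) (norm_nonneg _) (by positivity)
  have hIG : Integrable (fun x => frobeniusNormSq (fderiv ℝ w x)) := by
    refine integrable_of_norm_le_decay_mul_decay (C₁ := 3 * C) (C₂ := C) (r := r) (r' := r)
      (continuous_frobeniusNormSq_fderiv hw1 one_ne_zero) hr3 hr0 (by positivity) hC fun x => ?_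
    have hF0 : 0 ≤ frobeniusNormSq (fderiv ℝ w x) := frobeniusNormSq_nonneg (fderiv ℝ w x)
    calc ‖frobeniusNormSq (fderiv ℝ w x)‖ = frobeniusNormSq (fderiv ℝ w x) := by
          rw [Real.norm_eq_abs]; exact abs_of_nonneg hF0
      _ ≤ 3 * ‖fderiv ℝ w x‖ ^ 2 := frobeniusNormSq_le_three_mul_sq' _
      _ = 3 * ‖fderiv ℝ w x‖ * ‖fderiv ℝ w x‖ := by ring
      _ ≤ 3 * (C * (1 + ‖x‖) ^ (-r)) * (C * (1 + ‖x‖) ^ (-r)) :=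
          mul_le_mul (mul_le_mul_of_nonneg_left (h1 x) (by norm_num)) (h1 x) (norm_nonneg _)
            (mul_nonneg (by norm_num) (mul_nonneg hC (Real.rpow_nonneg (by positivity) _)))
      _ = 3 * C * (1 + ‖x‖) ^ (-r) * (C * (1 + ‖x‖) ^ (-r)) := by ring
  -- the pointwise bound `−2⟪w, f⟫ ≤ a |∇w|²_F + (a + 2b) ‖w‖²`
  have hpt : ∀ x, -(2 * ⟪w x, f x⟫) ≤
      a * frobeniusNormSq (fderiv ℝ w x) + (a + 2 * b) * ‖w x‖ ^ 2 := by
    intro x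
    have i1 : -(2 * ⟪w x, f x⟫) ≤ 2 * (‖w x‖ * ‖f x‖) := by
      have := abs_real_inner_le_norm (w x) (f x)
      have := neg_abs_le ⟪w x, f x⟫
      linarith
    have i2 : ‖fderiv ℝ w x‖ ^ 2 ≤ frobeniusNormSq (fderiv ℝ w x) := sq_opNorm_le_frobeniusNormSq _
    have hwn := norm_nonneg (w x)
    have hDn := norm_nonneg (fderiv ℝ w x)
    have i3 : ‖w x‖ * ‖f x‖ ≤ ‖w x‖ * (a * ‖fderiv ℝ w x‖ + b * ‖w x‖) :=
      mul_le_mul_of_nonneg_left (hf x) hwn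
    nlinarith [sq_nonneg (‖w x‖ - ‖fderiv ℝ w x‖), mul_nonneg ha hwn, mul_nonneg ha hDn]
  have hint : -(2 * ∫ x, ⟪w x, f x⟫) ≤
      a * VectorCalculus.gradNormSq w + (a + 2 * b) * ∫ x, ‖w x‖ ^ 2 := by
    rw [VectorCalculus.gradNormSq, ← integral_const_mul, ← integral_const_mul, ← integral_const_mul,
      ← integral_neg, ← integral_add (hIG.const_mul a) (hIe.const_mul (a + 2 * b))]
    exact integral_mono (hIf.const_mul 2).neg ((hIG.const_mul a).add (hIe.const_mul (a + 2 * b)))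
      fun x => hpt x
  rw [hid]
  have hG0 : 0 ≤ VectorCalculus.gradNormSq w := integral_nonneg fun x => frobeniusNormSq_nonneg _
  nlinarith [hint, hG0]

/-- **Temam's Lemma 6.1 on `ℝ³` (bounded-pressure form), with an undetermined multiplier.**
Under the hypotheses of `two_integral_inner_timeDeriv_eq_of_boundedPressure`, with `w ∈ C³`,
`w' ∈ C¹` and third-order decay (`r > 3`, `q` bounded), the enstrophy production `ψ = ∫ 2Σᵢ⟪∂ᵢw, ∂ᵢw'⟫ = −2∫⟪Δw, w'⟫` and the energy production
`φ = ∫ 2⟪w, w'⟫` satisfy, for every real `l` and `ν > 0`,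
`ν (ψ − l φ) ≤ a²‖∇w‖₂² + b²‖w‖₂² − 2ν² l (‖∇w‖₂² − l‖w‖₂²)`.
At `l = Λ = ‖∇w‖₂²/‖w‖₂²` this is the printed `½Λ' = −|Aw − Λw|²/|w|² + (Aw − Λw, h)/|w|² ≤ …`
(here: the pressure gradient is orthogonal to `Δw` because `div Δw = 0`, the term
`−|Δw + l w|²` absorbs `(Δw + l w, f)` by Young's inequality, and
`‖f‖² ≤ 2a²|∇w|² + 2b²|w|²`). [cite: Temam1997, Ch. III §6, Lemma 6.1, (6.9)–(6.11) (p. 172)] -/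
theorem dirichletQuotient_ineq_of_boundedPressure (hν : 0 < ν) (hw : ContDiff ℝ 3 w) (hw' : ContDiff ℝ 1 w')
    (hq : ContDiff ℝ 1 q) (hqb : ∀ x, ‖q x‖ ≤ Cq) (hdiv : VectorCalculus.IsDivFree w)
    (heq : ∀ x, w' x = ν • (Δ w) x - gradient q x + f x)
    (hf : ∀ x, ‖f x‖ ≤ a * ‖fderiv ℝ w x‖ + b * ‖w x‖) (hC : 0 ≤ C) (hr : 3 < r)
    (h0 : ∀ x, ‖w x‖ ≤ C * (1 + ‖x‖) ^ (-r)) (h1 : ∀ x, ‖fderiv ℝ w x‖ ≤ C * (1 + ‖x‖) ^ (-r))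
    (h2 : ∀ x, ‖fderiv ℝ (fderiv ℝ w) x‖ ≤ C * (1 + ‖x‖) ^ (-r))
    (h3 : ∀ x, ‖iteratedFDeriv ℝ 3 w x‖ ≤ C * (1 + ‖x‖) ^ (-r))
    (ht : ∀ x, ‖w' x‖ ≤ C * (1 + ‖x‖) ^ (-r)) (ht1 : ∀ x, ‖fderiv ℝ w' x‖ ≤ C * (1 + ‖x‖) ^ (-r))
    (l : ℝ) :
    ν * ((∫ x, 2 * ∑ i, ⟪fderiv ℝ w x (EuclideanSpace.basisFun (Fin 3) ℝ i),
        fderiv ℝ w' x (EuclideanSpace.basisFun (Fin 3) ℝ i)⟫) - l * ∫ x, 2 * ⟪w x, w' x⟫) ≤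
      a ^ 2 * VectorCalculus.gradNormSq w + b ^ 2 * (∫ x, ‖w x‖ ^ 2) -
        2 * ν ^ 2 * l * (VectorCalculus.gradNormSq w - l * ∫ x, ‖w x‖ ^ 2) := by
  set e := EuclideanSpace.basisFun (Fin 3) ℝ with he
  have hr3 : (Module.finrank ℝ (EuclideanSpace ℝ (Fin 3)) : ℝ) < r := by
    rw [finrank_euclideanSpace_fin_three_real']; linarith
  have hr0 : 0 ≤ r := by linarith
  have hw2 : ContDiff ℝ 2 w := hw.of_le (by norm_num)
  have hw1 : ContDiff ℝ 1 w := hw.of_le (by norm_num)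
  have hwc : Continuous w := hw.continuous
  have hDwc : Continuous (fderiv ℝ w) := hw.continuous_fderiv (by norm_num)
  have hw'c : Continuous w' := hw'.continuous
  have hDw'c : Continuous (fderiv ℝ w') := hw'.continuous_fderiv one_ne_zero
  have hΔc : Continuous (Δ w) := continuous_laplacian hw2
  obtain ⟨hIf, hid⟩ :=
    two_integral_inner_timeDeriv_eq_of_boundedPressure hw2 hw'c hq hqb hdiv heq hf hC hr h0 h1 h2 ht
  -- `f` is continuous and decays
  have hfeq : f = fun x => w' x - ν • (Δ w) x + gradient q x := by
    funext x; rw [heq x]; abel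
  have hfc : Continuous f := by
    rw [hfeq]
    exact (hw'c.sub (hΔc.const_smul ν)).add (continuous_gradient_of_contDiff hq)
  have hab : ∀ x, ‖f x‖ ≤ (|a| * C + |b| * C) * (1 + ‖x‖) ^ (-r) := by
    intro x
    calc ‖f x‖ ≤ a * ‖fderiv ℝ w x‖ + b * ‖w x‖ := hf x
      _ ≤ |a| * ‖fderiv ℝ w x‖ + |b| * ‖w x‖ := by
          gcongr <;> exact le_abs_self _
      _ ≤ |a| * (C * (1 + ‖x‖) ^ (-r)) + |b| * (C * (1 + ‖x‖) ^ (-r)) := by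
          gcongr
          · exact h1 x
          · exact h0 x
      _ = (|a| * C + |b| * C) * (1 + ‖x‖) ^ (-r) := by ring
  -- the Laplacian: `C¹`, divergence free, decaying with its derivative (constant `6C`)
  have hΔ1 : ContDiff ℝ 1 (Δ w) := contDiff_laplacian (n := 1) (by exact_mod_cast hw)
  have hdivΔ : VectorCalculus.IsDivFree (Δ w) := isDivFree_laplacian_of_contDiff_three hw hdiv
  have h6C : 0 ≤ 6 * C := by positivity
  have hΔ0 : ∀ x, ‖(Δ w) x‖ ≤ 6 * C * (1 + ‖x‖) ^ (-r) := by
    intro x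
    have hw0 : 0 ≤ (1 + ‖x‖) ^ (-r) := Real.rpow_nonneg (by positivity) _
    have h1' := norm_laplacian_le_three' w x
    have h2' := h2 x
    nlinarith [mul_nonneg hC hw0, norm_nonneg (fderiv ℝ (fderiv ℝ w) x)]
  have hΔ1b : ∀ x, ‖fderiv ℝ (Δ w) x‖ ≤ 6 * C * (1 + ‖x‖) ^ (-r) := by
    intro x
    have hsq := norm_fderiv_laplacian_sq_le hw x
    have hn1 := norm_nonneg (fderiv ℝ (Δ w) x)
    have hn2 := norm_nonneg (iteratedFDeriv ℝ 3 w x)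
    have h5 : ‖fderiv ℝ (Δ w) x‖ ≤ 6 * ‖iteratedFDeriv ℝ 3 w x‖ := by
      nlinarith [hsq, hn1, hn2]
    calc ‖fderiv ℝ (Δ w) x‖ ≤ 6 * ‖iteratedFDeriv ℝ 3 w x‖ := h5
      _ ≤ 6 * (C * (1 + ‖x‖) ^ (-r)) := by gcongr; exact h3 x
      _ = 6 * C * (1 + ‖x‖) ^ (-r) := by ring
  -- the pressure gradient is bounded
  have habC : 0 ≤ |a| * C + |b| * C := by positivity
  have hgradq : ∀ x, ‖gradient q x‖ ≤ |ν| * (6 * C) + (|a| * C + |b| * C) + C := by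
    intro x
    have eqn : gradient q x = ν • (Δ w) x + f x - w' x := by rw [heq x]; abel
    rw [eqn]
    have i1 : ‖ν • (Δ w) x‖ ≤ |ν| * (6 * C) := by
      rw [norm_smul, Real.norm_eq_abs]
      exact mul_le_mul_of_nonneg_left ((hΔ0 x).trans (decay_le_const x h6C hr0)) (abs_nonneg ν)
    have i2 : ‖f x‖ ≤ |a| * C + |b| * C := (hab x).trans (decay_le_const x habC hr0)
    have i3 : ‖w' x‖ ≤ C := (ht x).trans (decay_le_const x hC hr0)
    have i4 := norm_add_le (ν • (Δ w) x) (f x)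
    have i5 := norm_sub_le (ν • (Δ w) x + f x) (w' x)
    linarith
  -- ### (1) `ψ = −2 ∫ ⟪Δw, w'⟫`
  have hIBP : ∫ x, ∑ i, ⟪fderiv ℝ w x (e i), fderiv ℝ w' x (e i)⟫ = -∫ x, ⟪(Δ w) x, w' x⟫ := by
    refine integral_sum_inner_fderiv_fderiv_eq_neg_integral_inner_laplacian hw2 hw' ?_ ?_ ?_
    · -- `⟪∂ᵢ∂ᵢw, w'⟫`
      intro i
      have hci : Continuous (fun x => fderiv ℝ (fun y => fderiv ℝ w y (e i)) x (e i)) :=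
        ((((hw.fderiv_right (m := 2) (by norm_num)).clm_apply contDiff_const).continuous_fderiv
          (by norm_num)).clm_apply continuous_const)
      refine integrable_of_norm_le_decay_mul_decay (C₁ := C) (C₂ := C) (r := r) (r' := r)
        (hci.inner hw'c) hr3 hr0 hC hC fun x => (norm_inner_le_norm _ _).trans ?_
      refine mul_le_mul ?_ (ht x) (norm_nonneg _) (by positivity)
      have hdd : fderiv ℝ (fun y => fderiv ℝ w y (e i)) x (e i) =
          fderiv ℝ (fderiv ℝ w) x (e i) (e i) := by
        rw [fderiv_clm_apply ((hw2.fderiv_right (m := 1) (by norm_num)).differentiable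
          one_ne_zero x) (differentiableAt_const _)]
        simp
      rw [hdd]
      calc ‖fderiv ℝ (fderiv ℝ w) x (e i) (e i)‖ ≤ ‖fderiv ℝ (fderiv ℝ w) x (e i)‖ * ‖e i‖ :=
            ContinuousLinearMap.le_opNorm _ _
        _ ≤ ‖fderiv ℝ (fderiv ℝ w) x‖ * ‖e i‖ * ‖e i‖ := by
            gcongr; exact ContinuousLinearMap.le_opNorm _ _
        _ = ‖fderiv ℝ (fderiv ℝ w) x‖ := by simp [he]
        _ ≤ C * (1 + ‖x‖) ^ (-r) := h2 x
    · -- `⟪∂ᵢw, ∂ᵢw'⟫`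
      intro i
      refine integrable_of_norm_le_decay_mul_decay (C₁ := C) (C₂ := C) (r := r) (r' := r)
        ((hDwc.clm_apply continuous_const).inner (hDw'c.clm_apply continuous_const)) hr3 hr0 hC hC
        fun x => (norm_inner_le_norm _ _).trans ?_
      refine mul_le_mul ?_ ?_ (norm_nonneg _) (by positivity)
      · calc ‖fderiv ℝ w x (e i)‖ ≤ ‖fderiv ℝ w x‖ * ‖e i‖ := ContinuousLinearMap.le_opNorm _ _
          _ = ‖fderiv ℝ w x‖ := by simp [he]
          _ ≤ C * (1 + ‖x‖) ^ (-r) := h1 x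
      · calc ‖fderiv ℝ w' x (e i)‖ ≤ ‖fderiv ℝ w' x‖ * ‖e i‖ := ContinuousLinearMap.le_opNorm _ _
          _ = ‖fderiv ℝ w' x‖ := by simp [he]
          _ ≤ C * (1 + ‖x‖) ^ (-r) := ht1 x
    · -- `⟪∂ᵢw, w'⟫`
      intro i
      refine integrable_of_norm_le_decay_mul_decay (C₁ := C) (C₂ := C) (r := r) (r' := r)
        ((hDwc.clm_apply continuous_const).inner hw'c) hr3 hr0 hC hC
        fun x => (norm_inner_le_norm _ _).trans ?_
      refine mul_le_mul ?_ (ht x) (norm_nonneg _) (by positivity)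
      calc ‖fderiv ℝ w x (e i)‖ ≤ ‖fderiv ℝ w x‖ * ‖e i‖ := ContinuousLinearMap.le_opNorm _ _
        _ = ‖fderiv ℝ w x‖ := by simp [he]
        _ ≤ C * (1 + ‖x‖) ^ (-r) := h1 x
  -- ### (2) `∫ ⟪Δw, w'⟫ = ν ∫ ‖Δw‖² + ∫ ⟪Δw, f⟫` (the pressure pairs to zero with `Δw`)
  have hIN : Integrable (fun x => ‖(Δ w) x‖ ^ 2) := by
    refine integrable_of_norm_le_decay_mul_decay (C₁ := 6 * C) (C₂ := 6 * C) (r := r) (r' := r)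
      ((hΔc.norm).pow 2) hr3 hr0 h6C h6C fun x => ?_
    rw [norm_pow, norm_norm, sq]
    exact mul_le_mul (hΔ0 x) (hΔ0 x) (norm_nonneg _) (by positivity)
  have hIP : Integrable (fun x => ⟪(Δ w) x, f x⟫) := by
    refine integrable_of_norm_le_decay_mul_decay (C₁ := 6 * C) (C₂ := |a| * C + |b| * C) (r := r)
      (r' := r) (hΔc.inner hfc) hr3 hr0 h6C (by positivity)
      fun x => (norm_inner_le_norm _ _).trans ?_
    exact mul_le_mul (hΔ0 x) (hab x) (norm_nonneg _) (by positivity)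
  have hIΔq : Integrable (fun x => ⟪gradient q x, (Δ w) x⟫) := by
    refine integrable_of_norm_le_const_mul_decay (C₁ := |ν| * (6 * C) + (|a| * C + |b| * C) + C)
      (C₂ := 6 * C) (r := r) ((continuous_gradient_of_contDiff hq).inner hΔc) hr3
      fun x => (norm_inner_le_norm _ _).trans ?_
    exact mul_le_mul (hgradq x) (hΔ0 x) (norm_nonneg _) ((norm_nonneg _).trans (hgradq x))
  have hA2 : ∫ x, ⟪gradient q x, (Δ w) x⟫ = 0 :=
    integral_inner_gradient_eq_zero_of_bounded hΔ1 hq hdivΔ hr3 hΔ0 hΔ1b hqb hgradq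
  have hsplit : ∫ x, ⟪(Δ w) x, w' x⟫ = ν * (∫ x, ‖(Δ w) x‖ ^ 2) + ∫ x, ⟪(Δ w) x, f x⟫ := by
    have hpw : ∀ x, ⟪(Δ w) x, w' x⟫ =
        ν * ‖(Δ w) x‖ ^ 2 - ⟪gradient q x, (Δ w) x⟫ + ⟪(Δ w) x, f x⟫ := by
      intro x
      have hc : ⟪(Δ w) x, gradient q x⟫ = ⟪gradient q x, (Δ w) x⟫ := real_inner_comm _ _
      rw [heq x, inner_add_right, inner_sub_right, real_inner_smul_right, real_inner_self_eq_norm_sq,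
        hc]
    simp_rw [hpw]
    have hI1 : Integrable (fun x => ν * ‖(Δ w) x‖ ^ 2 - ⟪gradient q x, (Δ w) x⟫) :=
      (hIN.const_mul ν).sub hIΔq
    rw [integral_add hI1 hIP, integral_sub (hIN.const_mul ν) hIΔq,
      integral_const_mul, hA2, sub_zero]
  -- ### (3) `∫ ⟪Δw, w⟫ = −‖∇w‖₂²` and the integrable densities
  have hIR : Integrable (fun x => ⟪(Δ w) x, w x⟫) := by
    refine integrable_of_norm_le_decay_mul_decay (C₁ := 6 * C) (C₂ := C) (r := r) (r' := r)
      (hΔc.inner hwc) hr3 hr0 h6C hC fun x => (norm_inner_le_norm _ _).trans ?_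
    exact mul_le_mul (hΔ0 x) (h0 x) (norm_nonneg _) (by positivity)
  have hA1 : ∫ x, ⟪(Δ w) x, w x⟫ = -VectorCalculus.gradNormSq w :=
    integral_inner_laplacian_self_eq_neg_gradNormSq hw2 hC hr3 h0 h1 h2
  have hIe : Integrable (fun x => ‖w x‖ ^ 2) := by
    refine integrable_of_norm_le_decay_mul_decay (C₁ := C) (C₂ := C) (r := r) (r' := r)
      ((hwc.norm).pow 2) hr3 hr0 hC hC fun x => ?_
    rw [norm_pow, norm_norm, sq]
    exact mul_le_mul (h0 x) (h0 x) (norm_nonneg _) (by positivity)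
  have hIG : Integrable (fun x => frobeniusNormSq (fderiv ℝ w x)) := by
    refine integrable_of_norm_le_decay_mul_decay (C₁ := 3 * C) (C₂ := C) (r := r) (r' := r)
      (continuous_frobeniusNormSq_fderiv hw1 one_ne_zero) hr3 hr0 (by positivity) hC fun x => ?_
    have hF0 : 0 ≤ frobeniusNormSq (fderiv ℝ w x) := frobeniusNormSq_nonneg (fderiv ℝ w x)
    calc ‖frobeniusNormSq (fderiv ℝ w x)‖ = frobeniusNormSq (fderiv ℝ w x) := by
          rw [Real.norm_eq_abs]; exact abs_of_nonneg hF0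
      _ ≤ 3 * ‖fderiv ℝ w x‖ ^ 2 := frobeniusNormSq_le_three_mul_sq' _
      _ = 3 * ‖fderiv ℝ w x‖ * ‖fderiv ℝ w x‖ := by ring
      _ ≤ 3 * (C * (1 + ‖x‖) ^ (-r)) * (C * (1 + ‖x‖) ^ (-r)) :=
          mul_le_mul (mul_le_mul_of_nonneg_left (h1 x) (by norm_num)) (h1 x) (norm_nonneg _)
            (mul_nonneg (by norm_num) (mul_nonneg hC (Real.rpow_nonneg (by positivity) _)))
      _ = 3 * C * (1 + ‖x‖) ^ (-r) * (C * (1 + ‖x‖) ^ (-r)) := by ring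
  -- ### (4) the pointwise Young inequality, integrated
  have hpt : ∀ x, -(2 * (⟪(Δ w) x, f x⟫ + l * ⟪w x, f x⟫)) * ν ≤
      2 * ν ^ 2 * (‖(Δ w) x‖ ^ 2 + 2 * l * ⟪(Δ w) x, w x⟫ + l ^ 2 * ‖w x‖ ^ 2) +
        (a ^ 2 * frobeniusNormSq (fderiv ℝ w x) + b ^ 2 * ‖w x‖ ^ 2) := by
    intro x
    -- `g = Δw + l w`, `‖g‖² = ‖Δw‖² + 2l⟪Δw, w⟫ + l²‖w‖²`
    have hg : ‖(Δ w) x + l • w x‖ ^ 2 = ‖(Δ w) x‖ ^ 2 + 2 * l * ⟪(Δ w) x, w x⟫ + l ^ 2 * ‖w x‖ ^ 2 := by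
      rw [norm_add_sq_real, real_inner_smul_right, norm_smul, mul_pow, Real.norm_eq_abs, sq_abs]
      ring
    have hinner : ⟪(Δ w) x, f x⟫ + l * ⟪w x, f x⟫ = ⟪(Δ w) x + l • w x, f x⟫ := by
      rw [inner_add_left, real_inner_smul_left]
    have i1 : -(2 * ⟪(Δ w) x + l • w x, f x⟫) ≤ 2 * (‖(Δ w) x + l • w x‖ * ‖f x‖) := by
      have := abs_real_inner_le_norm ((Δ w) x + l • w x) (f x)
      have := neg_abs_le ⟪(Δ w) x + l • w x, f x⟫
      linarith
    have i2 : ‖fderiv ℝ w x‖ ^ 2 ≤ frobeniusNormSq (fderiv ℝ w x) := sq_opNorm_le_frobeniusNormSq _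
    have i1' : -(2 * (⟪(Δ w) x, f x⟫ + l * ⟪w x, f x⟫)) ≤ 2 * (‖(Δ w) x + l • w x‖ * ‖f x‖) := by
      rw [hinner]; exact i1
    exact LogConvexity.young_aux' hν (norm_nonneg _) hg i1' i2 (hf x)
  have hIlhs : Integrable (fun x => -(2 * (⟪(Δ w) x, f x⟫ + l * ⟪w x, f x⟫)) * ν) :=
    ((hIP.add (hIf.const_mul l)).const_mul 2).neg.mul_const ν
  have hIrhs : Integrable (fun x =>
      2 * ν ^ 2 * (‖(Δ w) x‖ ^ 2 + 2 * l * ⟪(Δ w) x, w x⟫ + l ^ 2 * ‖w x‖ ^ 2) +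
        (a ^ 2 * frobeniusNormSq (fderiv ℝ w x) + b ^ 2 * ‖w x‖ ^ 2)) :=
    (((hIN.add (hIR.const_mul (2 * l))).add (hIe.const_mul (l ^ 2))).const_mul (2 * ν ^ 2)).add
      ((hIG.const_mul (a ^ 2)).add (hIe.const_mul (b ^ 2)))
  have hint := integral_mono hIlhs hIrhs fun x => hpt x
  -- evaluate both sides of the integrated inequality
  have hL : ∫ x, -(2 * (⟪(Δ w) x, f x⟫ + l * ⟪w x, f x⟫)) * ν =
      -(2 * ((∫ x, ⟪(Δ w) x, f x⟫) + l * ∫ x, ⟪w x, f x⟫)) * ν := by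
    rw [integral_mul_const, integral_neg, integral_const_mul, integral_add hIP (hIf.const_mul l),
      integral_const_mul]
  have hR : ∫ x, (2 * ν ^ 2 * (‖(Δ w) x‖ ^ 2 + 2 * l * ⟪(Δ w) x, w x⟫ + l ^ 2 * ‖w x‖ ^ 2) +
        (a ^ 2 * frobeniusNormSq (fderiv ℝ w x) + b ^ 2 * ‖w x‖ ^ 2)) =
      2 * ν ^ 2 * ((∫ x, ‖(Δ w) x‖ ^ 2) + 2 * l * (∫ x, ⟪(Δ w) x, w x⟫) + l ^ 2 * ∫ x, ‖w x‖ ^ 2) +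
        (a ^ 2 * VectorCalculus.gradNormSq w + b ^ 2 * ∫ x, ‖w x‖ ^ 2) := by
    have hJ1 : Integrable (fun x => ‖(Δ w) x‖ ^ 2 + 2 * l * ⟪(Δ w) x, w x⟫) :=
      hIN.add (hIR.const_mul (2 * l))
    have hJ2 : Integrable (fun x => ‖(Δ w) x‖ ^ 2 + 2 * l * ⟪(Δ w) x, w x⟫ + l ^ 2 * ‖w x‖ ^ 2) :=
      hJ1.add (hIe.const_mul (l ^ 2))
    have hJ3 : Integrable (fun x =>
        2 * ν ^ 2 * (‖(Δ w) x‖ ^ 2 + 2 * l * ⟪(Δ w) x, w x⟫ + l ^ 2 * ‖w x‖ ^ 2)) :=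
      hJ2.const_mul (2 * ν ^ 2)
    have hJ4 : Integrable (fun x => a ^ 2 * frobeniusNormSq (fderiv ℝ w x) + b ^ 2 * ‖w x‖ ^ 2) :=
      (hIG.const_mul (a ^ 2)).add (hIe.const_mul (b ^ 2))
    rw [integral_add hJ3 hJ4, integral_const_mul, integral_add hJ1 (hIe.const_mul (l ^ 2)),
      integral_add hIN (hIR.const_mul (2 * l)), integral_const_mul, integral_const_mul,
      integral_add (hIG.const_mul (a ^ 2)) (hIe.const_mul (b ^ 2)), integral_const_mul,
      integral_const_mul, VectorCalculus.gradNormSq]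
  rw [hL, hR, hA1] at hint
  -- ### (5) assemble
  have hψ : ∫ x, 2 * ∑ i, ⟪fderiv ℝ w x (e i), fderiv ℝ w' x (e i)⟫ =
      -2 * (ν * (∫ x, ‖(Δ w) x‖ ^ 2) + ∫ x, ⟪(Δ w) x, f x⟫) := by
    rw [integral_const_mul, hIBP, hsplit]; ring
  rw [hψ, hid]
  nlinarith [hint]

end FixedTime

/-! ### §3. Lemma 6.2 under six uniform bounds (`r > 3`) and a slice-wise bounded pressure -/

section Assembly

open InnerProductSpace
open scoped Laplacian

/-- **Backward uniqueness for the perturbed Stokes structure under finite-order decay and a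
bounded pressure (Temam 1997, Ch. III, Lemma 6.2, whole-space classical rendering).** Let
`w : [0, T] × ℝ³ → ℝ³` be jointly smooth with divergence-free slices, and suppose that on the open
time interval it solves `∂ₜw = νΔw − ∇q + f` with `ν > 0`, `q(t) ∈ C¹` BOUNDED on each slice
(any bound, depending on `t`), and `‖f(t,x)‖ ≤ a‖∇w(t,x)‖ + b‖w(t,x)‖`. Assume the six uniform
polynomial bounds `‖w‖, ‖∇w‖, ‖∇²w‖, ‖∇³w‖, ‖∂ₜw‖, ‖∇∂ₜw‖ ≤ C(1 + |x|)^{-r}` on `[0, T] × ℝ³` for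
some `r > 3 = dim`. If `w(T) = 0` then `w ≡ 0` on `[0, T] × ℝ³`. Proof: verbatim that of
`eq_zero_of_perturbedStokes_backward` with the bounded-pressure fixed-time lemmas of §2:
`E(t) = ‖w(t)‖₂²`, `G(t) = ‖∇w(t)‖₂²` are continuous on `[0, T]` and differentiable on `(0, T)`
by dominated differentiation under the integral sign, and
`neg_two_integral_inner_timeDeriv_le_of_boundedPressure` ((6.14)) and
`dirichletQuotient_ineq_of_boundedPressure` (Lemma 6.1) feed `LogConvexity.eq_zero_of_backward`
(Lemma 6.2). [cite: Temam1997, Ch. III §6, Lemma 6.2 with Lemma 6.1 and §6.2 (pp. 172–175)] -/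
theorem eq_zero_of_perturbedStokes_backward_of_boundedPressure {T ν a b C r : ℝ} (hT : 0 < T) (hν : 0 < ν)
    (ha : 0 ≤ a) (hb : 0 ≤ b) (hC : 0 ≤ C) (hr : 3 < r)
    {w f : ℝ → EuclideanSpace ℝ (Fin 3) → EuclideanSpace ℝ (Fin 3)}
    {q : ℝ → EuclideanSpace ℝ (Fin 3) → ℝ}
    (hw : IsSmoothSpaceTimeOn (Icc 0 T) w)
    (h0 : ∀ t ∈ Icc 0 T, ∀ x, ‖w t x‖ ≤ C * (1 + ‖x‖) ^ (-r))
    (h1 : ∀ t ∈ Icc 0 T, ∀ x, ‖fderiv ℝ (w t) x‖ ≤ C * (1 + ‖x‖) ^ (-r))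
    (h2 : ∀ t ∈ Icc 0 T, ∀ x, ‖fderiv ℝ (fderiv ℝ (w t)) x‖ ≤ C * (1 + ‖x‖) ^ (-r))
    (h3 : ∀ t ∈ Icc 0 T, ∀ x, ‖iteratedFDeriv ℝ 3 (w t) x‖ ≤ C * (1 + ‖x‖) ^ (-r))
    (ht : ∀ t ∈ Icc 0 T, ∀ x, ‖timeDerivWithin (Icc 0 T) w t x‖ ≤ C * (1 + ‖x‖) ^ (-r))
    (ht1 : ∀ t ∈ Icc 0 T, ∀ x,
      ‖fderiv ℝ (timeDerivWithin (Icc 0 T) w t) x‖ ≤ C * (1 + ‖x‖) ^ (-r))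
    (hq : ∀ t ∈ Ioo 0 T, ContDiff ℝ 1 (q t)) (hqb : ∀ t ∈ Ioo 0 T, ∃ Cq : ℝ, ∀ x, ‖q t x‖ ≤ Cq)
    (hdiv : ∀ t ∈ Ioo 0 T, VectorCalculus.IsDivFree (w t))
    (heq : ∀ t ∈ Ioo 0 T, ∀ x,
      timeDerivWithin (Icc 0 T) w t x = ν • (Δ (w t)) x - gradient (q t) x + f t x)
    (hf : ∀ t ∈ Ioo 0 T, ∀ x, ‖f t x‖ ≤ a * ‖fderiv ℝ (w t) x‖ + b * ‖w t x‖)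
    (hfin : ∀ x, w T x = 0) : ∀ t ∈ Icc 0 T, ∀ x, w t x = 0 := by
  set S : Set ℝ := Icc 0 T with hS_def
  have hS : UniqueDiffOn ℝ S := uniqueDiffOn_Icc hT
  set e := EuclideanSpace.basisFun (Fin 3) ℝ with he
  set w' : ℝ → EuclideanSpace ℝ (Fin 3) → EuclideanSpace ℝ (Fin 3) := timeDerivWithin S w
    with hw'_def
  have hw'sm : IsSmoothSpaceTimeOn S w' := hw.timeDerivWithin hS
  have hr3 : (Module.finrank ℝ (EuclideanSpace ℝ (Fin 3)) : ℝ) < r := by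
    rw [finrank_euclideanSpace_fin]; push_cast; linarith
  have hK0 : (0 : ℝ) ≤ r := by linarith
  -- ## regularity of slices
  have hwc : ∀ s ∈ S, Continuous (w s) := fun s hs => hw.continuous_slice hs
  have hw3 : ∀ s ∈ S, ContDiff ℝ 3 (w s) := fun s hs => contDiff_infty.1 (hw.contDiff_slice hs) 3
  have hw2 : ∀ s ∈ S, ContDiff ℝ 2 (w s) := fun s hs => (hw3 s hs).of_le (by norm_num)
  have hw1 : ∀ s ∈ S, ContDiff ℝ 1 (w s) := fun s hs => (hw3 s hs).of_le (by norm_num)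
  have hw'1 : ∀ s ∈ S, ContDiff ℝ 1 (w' s) := fun s hs =>
    contDiff_infty.1 (hw'sm.contDiff_slice hs) 1
  have hw'c : ∀ s ∈ S, Continuous (w' s) := fun s hs => hw'sm.continuous_slice hs
  have hDwc : ∀ s ∈ S, Continuous (fderiv ℝ (w s)) := fun s hs =>
    (hw1 s hs).continuous_fderiv one_ne_zero
  have hDw'c : ∀ s ∈ S, Continuous (fderiv ℝ (w' s)) := fun s hs =>
    (hw'1 s hs).continuous_fderiv one_ne_zero
  have hwt_c : ∀ x, ContinuousOn (fun s => w s x) S := fun x => hw.continuousOn_time x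
  have he1 : ∀ i, ‖e i‖ = 1 := fun i => e.orthonormal.1 i
  have hLe : ∀ (L : EuclideanSpace ℝ (Fin 3) →L[ℝ] EuclideanSpace ℝ (Fin 3)) (i : Fin 3),
      ‖L (e i)‖ ≤ ‖L‖ := fun L i => (L.le_opNorm (e i)).trans_eq (by rw [he1, mul_one])
  -- ## the energy `E`, the enstrophy `G`, and their productions `φ`, `ψ`
  set E : ℝ → ℝ := fun s => ∫ x, ‖w s x‖ ^ 2 with hE_def
  set G : ℝ → ℝ := fun s => VectorCalculus.gradNormSq (w s) with hG_def
  set φ : ℝ → ℝ := fun s => ∫ x, 2 * ⟪w s x, w' s x⟫ with hφ_def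
  set ψ : ℝ → ℝ := fun s => ∫ x, 2 * ∑ i, ⟪fderiv ℝ (w s) x (e i), fderiv ℝ (w' s) x (e i)⟫
    with hψ_def
  -- dominating function
  set bound : EuclideanSpace ℝ (Fin 3) → ℝ := fun x => 6 * C * C * (1 + ‖x‖) ^ (-r)
    with hbound_def
  have hbound : Integrable bound := by
    have := (integrable_one_add_norm (E := EuclideanSpace ℝ (Fin 3)) (μ := volume) hr3).const_mul
      (6 * C * C)
    simpa [hbound_def] using this
  have hprod : ∀ x : EuclideanSpace ℝ (Fin 3), ∀ {p ρ : ℝ}, 0 ≤ p → 0 ≤ ρ →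
      p ≤ C * (1 + ‖x‖) ^ (-r) → ρ ≤ C * (1 + ‖x‖) ^ (-r) →
      p * ρ ≤ C * C * (1 + ‖x‖) ^ (-r) := by
    intro x p ρ hp hρ0 hp1 hρ1
    have hw0 : 0 ≤ (1 + ‖x‖) ^ (-r) := Real.rpow_nonneg (by positivity) _
    have hw1 : (1 + ‖x‖) ^ (-r) ≤ 1 := rpow_neg_le_one x hK0
    calc p * ρ ≤ C * (1 + ‖x‖) ^ (-r) * (C * (1 + ‖x‖) ^ (-r)) :=
          mul_le_mul hp1 hρ1 hρ0 (mul_nonneg hC hw0)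
      _ ≤ C * 1 * (C * (1 + ‖x‖) ^ (-r)) := by gcongr
      _ = C * C * (1 + ‖x‖) ^ (-r) := by ring
  -- ### (B1) `E` is continuous on `S`, differentiable on the interior with derivative `φ`
  have hEle : ∀ s ∈ S, ∀ x, ‖‖w s x‖ ^ 2‖ ≤ bound x := by
    intro s hs x
    rw [norm_pow, norm_norm, sq, hbound_def]
    have := hprod x (norm_nonneg _) (norm_nonneg _) (h0 s hs x) (h0 s hs x)
    have hw0 : 0 ≤ C * C * (1 + ‖x‖) ^ (-r) := by positivity
    linarith
  have hφle : ∀ s ∈ S, ∀ x, ‖2 * ⟪w s x, w' s x⟫‖ ≤ bound x := by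
    intro s hs x
    rw [norm_mul, Real.norm_two, hbound_def]
    have h := hprod x (norm_nonneg _) (norm_nonneg _) (h0 s hs x) (ht s hs x)
    have h' : ‖⟪w s x, w' s x⟫‖ ≤ ‖w s x‖ * ‖w' s x‖ := norm_inner_le_norm _ _
    have hw0 : 0 ≤ C * C * (1 + ‖x‖) ^ (-r) := by positivity
    linarith
  have hIE : ∀ s ∈ S, Integrable (fun x => ‖w s x‖ ^ 2) := fun s hs =>
    Integrable.mono' hbound (((hwc s hs).norm).pow 2).aestronglyMeasurable
      (Eventually.of_forall (hEle s hs))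
  have hEc : ContinuousOn E S := by
    refine continuousOn_of_dominated (bound := bound) (fun s hs => ?_) (fun s hs => ?_) hbound ?_
    · exact (((hwc s hs).norm).pow 2).aestronglyMeasurable
    · exact Eventually.of_forall (hEle s hs)
    · exact Eventually.of_forall fun x => ((hwt_c x).norm).pow 2
  have hEd : ∀ s ∈ Ioo 0 T, HasDerivAt E (φ s) s := by
    intro s hs
    have hsS : s ∈ S := Ioo_subset_Icc_self hs
    have hIoo : Ioo 0 T ∈ 𝓝 s := Ioo_mem_nhds hs.1 hs.2
    have key := hasDerivAt_integral_of_dominated_loc_of_deriv_le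
      (μ := (volume : Measure (EuclideanSpace ℝ (Fin 3))))
      (F := fun σ x => ‖w σ x‖ ^ 2) (F' := fun σ x => 2 * ⟪w σ x, w' σ x⟫) (x₀ := s)
      (bound := bound) hIoo ?_ (hIE s hsS) ?_ ?_ hbound ?_
    · exact key.2
    · filter_upwards [hIoo] with σ hσ
      exact (((hwc σ (Ioo_subset_Icc_self hσ)).norm).pow 2).aestronglyMeasurable
    · exact (((hwc s hsS).inner (hw'c s hsS)).const_mul 2).aestronglyMeasurable
    · exact Eventually.of_forall fun x σ hσ => hφle σ (Ioo_subset_Icc_self hσ) x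
    · refine Eventually.of_forall fun x σ hσ => ?_
      have hσS : σ ∈ S := Ioo_subset_Icc_self hσ
      have hSσ : S ∈ 𝓝 σ := mem_of_superset (Ioo_mem_nhds hσ.1 hσ.2) Ioo_subset_Icc_self
      exact ((hw.hasDerivWithinAt_timeDerivWithin hS hσS x).hasDerivAt hSσ).norm_sq
  -- ### (B2) `G` is differentiable on the interior with derivative `ψ`
  have hGeq : ∀ s, G s = ∫ x, ∑ i, ‖fderiv ℝ (w s) x (e i)‖ ^ 2 := by
    intro s
    simp only [hG_def, VectorCalculus.gradNormSq, frobeniusNormSq_eq_sum e]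
  have hGle : ∀ s ∈ S, ∀ x, ‖∑ i, ‖fderiv ℝ (w s) x (e i)‖ ^ 2‖ ≤ bound x := by
    intro s hs x
    rw [Real.norm_of_nonneg (Finset.sum_nonneg fun i _ => sq_nonneg _), hbound_def]
    have hi : ∀ i, ‖fderiv ℝ (w s) x (e i)‖ ^ 2 ≤ C * C * (1 + ‖x‖) ^ (-r) := by
      intro i
      have hn : ‖fderiv ℝ (w s) x (e i)‖ ≤ C * (1 + ‖x‖) ^ (-r) :=
        (hLe _ i).trans (h1 s hs x)
      rw [sq]; exact hprod x (norm_nonneg _) (norm_nonneg _) hn hn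
    calc ∑ i, ‖fderiv ℝ (w s) x (e i)‖ ^ 2 ≤ ∑ _i : Fin 3, C * C * (1 + ‖x‖) ^ (-r) :=
          Finset.sum_le_sum fun i _ => hi i
      _ = 3 * (C * C * (1 + ‖x‖) ^ (-r)) := by simp
      _ ≤ 6 * C * C * (1 + ‖x‖) ^ (-r) := by
          have : 0 ≤ C * C * (1 + ‖x‖) ^ (-r) := by positivity
          linarith
  have hψle : ∀ s ∈ S, ∀ x,
      ‖2 * ∑ i, ⟪fderiv ℝ (w s) x (e i), fderiv ℝ (w' s) x (e i)⟫‖ ≤ bound x := by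
    intro s hs x
    rw [norm_mul, Real.norm_two, hbound_def]
    have hi : ∀ i, ‖⟪fderiv ℝ (w s) x (e i), fderiv ℝ (w' s) x (e i)⟫‖ ≤
        C * C * (1 + ‖x‖) ^ (-r) := by
      intro i
      exact (norm_inner_le_norm _ _).trans (hprod x (norm_nonneg _) (norm_nonneg _)
        ((hLe _ i).trans (h1 s hs x)) ((hLe _ i).trans (ht1 s hs x)))
    calc 2 * ‖∑ i, ⟪fderiv ℝ (w s) x (e i), fderiv ℝ (w' s) x (e i)⟫‖
        ≤ 2 * ∑ i, ‖⟪fderiv ℝ (w s) x (e i), fderiv ℝ (w' s) x (e i)⟫‖ := by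
          gcongr; exact norm_sum_le _ _
      _ ≤ 2 * ∑ _i : Fin 3, C * C * (1 + ‖x‖) ^ (-r) := by
          gcongr with i _; exact hi i
      _ = 6 * C * C * (1 + ‖x‖) ^ (-r) := by simp; ring
  have hGcont : ∀ s ∈ S, Continuous (fun x => ∑ i, ‖fderiv ℝ (w s) x (e i)‖ ^ 2) := fun s hs =>
    continuous_finsetSum _ fun i _ => (((hDwc s hs).clm_apply continuous_const).norm).pow 2
  have hIG : ∀ s ∈ S, Integrable (fun x => ∑ i, ‖fderiv ℝ (w s) x (e i)‖ ^ 2) := fun s hs =>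
    Integrable.mono' hbound (hGcont s hs).aestronglyMeasurable (Eventually.of_forall (hGle s hs))
  have hGd : ∀ s ∈ Ioo 0 T, HasDerivAt G (ψ s) s := by
    intro s hs
    have hsS : s ∈ S := Ioo_subset_Icc_self hs
    have hIoo : Ioo 0 T ∈ 𝓝 s := Ioo_mem_nhds hs.1 hs.2
    have key := hasDerivAt_integral_of_dominated_loc_of_deriv_le
      (μ := (volume : Measure (EuclideanSpace ℝ (Fin 3))))
      (F := fun σ x => ∑ i, ‖fderiv ℝ (w σ) x (e i)‖ ^ 2)
      (F' := fun σ x => 2 * ∑ i, ⟪fderiv ℝ (w σ) x (e i), fderiv ℝ (w' σ) x (e i)⟫) (x₀ := s)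
      (bound := bound) hIoo ?_ (hIG s hsS) ?_ ?_ hbound ?_
    · have hG' : G = fun σ => ∫ x, ∑ i, ‖fderiv ℝ (w σ) x (e i)‖ ^ 2 := funext hGeq
      rw [hG']
      exact key.2
    · filter_upwards [hIoo] with σ hσ
      exact (hGcont σ (Ioo_subset_Icc_self hσ)).aestronglyMeasurable
    · exact ((continuous_finsetSum _ fun i _ => ((hDwc s hsS).clm_apply continuous_const).inner
        ((hDw'c s hsS).clm_apply continuous_const)).const_mul 2).aestronglyMeasurable
    · exact Eventually.of_forall fun x σ hσ => hψle σ (Ioo_subset_Icc_self hσ) x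
    · refine Eventually.of_forall fun x σ hσ => ?_
      have hD : HasDerivAt (fun τ => fderiv ℝ (w τ) x) (fderiv ℝ (w' σ) x) σ :=
        hw.hasDerivAt_fderiv_slice_timeDerivWithin isOpen_Ioo Ioo_subset_Icc_self hσ x
      have hDi : ∀ i, HasDerivAt (fun τ => fderiv ℝ (w τ) x (e i)) (fderiv ℝ (w' σ) x (e i)) σ :=
        fun i => by
          simpa using hD.clm_apply (hasDerivAt_const σ (e i))
      have hsum := HasDerivAt.sum (u := Finset.univ)
        (A := fun i τ => ‖fderiv ℝ (w τ) x (e i)‖ ^ 2)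
        (A' := fun i => 2 * ⟪fderiv ℝ (w σ) x (e i), fderiv ℝ (w' σ) x (e i)⟫)
        (x := σ) fun i _ => (hDi i).norm_sq
      simp only [Finset.mul_sum]
      convert hsum using 1
      funext τ; simp
  -- ### (B3) the two fixed-time inequalities on the interior
  set Kc : ℝ := 2 * ν + a + 2 * b + (a ^ 2 + b ^ 2) / ν + 1 with hKc
  have hKc0 : 0 ≤ Kc := by rw [hKc]; positivity
  have hE0 : ∀ s ∈ Ioo 0 T, 0 ≤ E s := fun s hs => integral_nonneg fun x => sq_nonneg _
  have hG0 : ∀ s ∈ Ioo 0 T, 0 ≤ G s := fun s hs =>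
    integral_nonneg fun x => frobeniusNormSq_nonneg _
  have hφineq : ∀ s ∈ Ioo 0 T, -φ s ≤ Kc * (G s + E s) := by
    intro s hs
    have hsS : s ∈ S := Ioo_subset_Icc_self hs
    obtain ⟨Cq, hCq⟩ := hqb s hs
    have h := neg_two_integral_inner_timeDeriv_le_of_boundedPressure ha (hw2 s hsS) (hw'c s hsS)
      (hq s hs) hCq (hdiv s hs) (heq s hs) (hf s hs) hC hr (h0 s hsS) (h1 s hsS) (h2 s hsS)
      (ht s hsS)
    have hG := hG0 s hs; have hE := hE0 s hs
    have h1' : (2 * ν + a) * G s ≤ Kc * G s := by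
      apply mul_le_mul_of_nonneg_right _ hG
      rw [hKc]; have : 0 ≤ (a ^ 2 + b ^ 2) / ν := by positivity
      linarith
    have h2' : (a + 2 * b) * E s ≤ Kc * E s := by
      apply mul_le_mul_of_nonneg_right _ hE
      rw [hKc]; have : 0 ≤ (a ^ 2 + b ^ 2) / ν := by positivity
      linarith [hν.le]
    simp only [hφ_def, hG_def, hE_def] at h ⊢
    linarith
  have hψineq : ∀ s ∈ Ioo 0 T, 0 < E s → ψ s * E s - G s * φ s ≤ Kc * (G s + E s) * E s := by
    intro s hs hEs
    have hsS : s ∈ S := Ioo_subset_Icc_self hs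
    obtain ⟨Cq, hCq⟩ := hqb s hs
    have h := dirichletQuotient_ineq_of_boundedPressure hν (hw3 s hsS) (hw'1 s hsS) (hq s hs) hCq
      (hdiv s hs) (heq s hs) (hf s hs) hC hr (h0 s hsS) (h1 s hsS) (h2 s hsS) (h3 s hsS)
      (ht s hsS) (ht1 s hsS) (G s / E s)
    exact LogConvexity.quotient_aux' (ψ := ψ s) (φ := φ s) hν hEs (hG0 s hs) ha hb h
  -- ### (B4) Temam's Lemma 6.2
  have hET : E T = 0 := by simp [hE_def, hfin]
  have hmain := LogConvexity.eq_zero_of_backward hT hKc0 hEc hEd hGd hE0 hG0 hφineq hψineq hET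
  -- ### conclusion: `w t x = 0` pointwise, by continuity
  intro t htS x
  have het : E t = 0 := hmain t htS
  have hae : (fun y => ‖w t y‖ ^ 2) =ᵐ[volume] 0 :=
    (integral_eq_zero_iff_of_nonneg (fun y => sq_nonneg _) (hIE t htS)).1 het
  have hzero : (fun y => ‖w t y‖ ^ 2) = 0 :=
    ((((hwc t htS).norm).pow 2).ae_eq_iff_eq volume continuous_const).1 hae
  have hx := congrFun hzero x
  simpa using hx

end Assembly

/-! ### §4. Two classical Navier–Stokes flows (Temam §6.2) -/

section NavierStokes

open InnerProductSpace
open scoped Laplacian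

/-- **Backward uniqueness for the linearised Navier–Stokes structure under finite-order decay
and a bounded pressure**
(Temam 1997, Ch. III §6.2, the case `h = −B(u, w) − B(w, v)` of Lemma 6.2; Bardos–Tartar 1973).
Let `U₁, U₂` be fields on `(0, T) × ℝ³` with `‖U₁‖ ≤ A` and `‖∇U₂‖ ≤ B`, and let `w` be a
jointly smooth divergence-free solution on `(0, T)` of `∂ₜw + (U₁·∇)w + (w·∇)U₂ = νΔw − ∇q`,
`ν > 0`, `q(t) ∈ C¹`, `q(t)` bounded on each slice, obeying the six uniform bounds `≤ C(1 + |x|)^{-r}`, `r > 3`,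
of `eq_zero_of_perturbedStokes_backward_of_boundedPressure`. If `w(T) = 0` then `w ≡ 0` on `[0, T]`.
[cite: Temam1997, Ch. III §6.2 with Lemma 6.2 (pp. 174–175)] -/
theorem linearisedNS_backward_unique_of_boundedPressure {T ν A B C r : ℝ} (hT : 0 < T) (hν : 0 < ν)
    (hA : 0 ≤ A) (hB : 0 ≤ B) (hC : 0 ≤ C) (hr : 3 < r)
    {U₁ U₂ w : ℝ → EuclideanSpace ℝ (Fin 3) → EuclideanSpace ℝ (Fin 3)}
    {q : ℝ → EuclideanSpace ℝ (Fin 3) → ℝ}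
    (hU₁ : ∀ t ∈ Ioo 0 T, ∀ x, ‖U₁ t x‖ ≤ A) (hU₂ : ∀ t ∈ Ioo 0 T, ∀ x, ‖fderiv ℝ (U₂ t) x‖ ≤ B)
    (hw : IsSmoothSpaceTimeOn (Icc 0 T) w)
    (h0 : ∀ t ∈ Icc 0 T, ∀ x, ‖w t x‖ ≤ C * (1 + ‖x‖) ^ (-r))
    (h1 : ∀ t ∈ Icc 0 T, ∀ x, ‖fderiv ℝ (w t) x‖ ≤ C * (1 + ‖x‖) ^ (-r))
    (h2 : ∀ t ∈ Icc 0 T, ∀ x, ‖fderiv ℝ (fderiv ℝ (w t)) x‖ ≤ C * (1 + ‖x‖) ^ (-r))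
    (h3 : ∀ t ∈ Icc 0 T, ∀ x, ‖iteratedFDeriv ℝ 3 (w t) x‖ ≤ C * (1 + ‖x‖) ^ (-r))
    (ht : ∀ t ∈ Icc 0 T, ∀ x, ‖timeDerivWithin (Icc 0 T) w t x‖ ≤ C * (1 + ‖x‖) ^ (-r))
    (ht1 : ∀ t ∈ Icc 0 T, ∀ x,
      ‖fderiv ℝ (timeDerivWithin (Icc 0 T) w t) x‖ ≤ C * (1 + ‖x‖) ^ (-r))
    (hq : ∀ t ∈ Ioo 0 T, ContDiff ℝ 1 (q t)) (hqb : ∀ t ∈ Ioo 0 T, ∃ Cq : ℝ, ∀ x, ‖q t x‖ ≤ Cq)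
    (hdiv : ∀ t ∈ Ioo 0 T, VectorCalculus.IsDivFree (w t))
    (heq : ∀ t ∈ Ioo 0 T, ∀ x,
      timeDerivWithin (Icc 0 T) w t x + convect (U₁ t) (w t) x + convect (w t) (U₂ t) x =
        ν • (Δ (w t)) x - gradient (q t) x)
    (hfin : ∀ x, w T x = 0) : ∀ t ∈ Icc 0 T, ∀ x, w t x = 0 := by
  refine eq_zero_of_perturbedStokes_backward_of_boundedPressure hT hν hA hB hC hr hw h0 h1 h2 h3 ht
    ht1 hq hqb hdiv (f := fun t x => -(convect (U₁ t) (w t) x + convect (w t) (U₂ t) x))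
    (fun t ht' x => ?_) (fun t ht' x => ?_) hfin
  · rw [← heq t ht' x]; abel
  · rw [norm_neg, convect_apply, convect_apply]
    refine (norm_add_le _ _).trans ?_
    have e1 : ‖fderiv ℝ (w t) x (U₁ t x)‖ ≤ A * ‖fderiv ℝ (w t) x‖ :=
      (ContinuousLinearMap.le_opNorm _ _).trans (by
        rw [mul_comm]; exact mul_le_mul_of_nonneg_right (hU₁ t ht' x) (norm_nonneg _))
    have e2 : ‖fderiv ℝ (U₂ t) x (w t x)‖ ≤ B * ‖w t x‖ :=
      (ContinuousLinearMap.le_opNorm _ _).trans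
        (mul_le_mul_of_nonneg_right (hU₂ t ht' x) (norm_nonneg _))
    exact add_le_add e1 e2

/-- **Backward uniqueness of classical Navier–Stokes flows on `ℝ³` under finite-order decay of
the difference and a bounded pressure difference** (Temam 1997, Ch. III §6.2: "if `u(T) = v(T)` then `u(t) = v(t)` for all
`t ∈ [0, T]`", by the log-convexity Lemma 6.2 going back to Bardos–Tartar 1973; whole-space
classical rendering). Let `(u₁, p₁)`, `(u₂, p₂)` be classical solutions of the forced Navier–Stokes
equations on `[0, T] × ℝ³` with the same viscosity `ν > 0` and the same force, with
`‖u₁‖ ≤ A` and `‖∇u₂‖ ≤ B` on `(0, T) × ℝ³` (Temam's `k = k(‖u‖_∞, ‖∇v‖_∞)` in (6.17)), and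
the pressure DIFFERENCE `p₁(t) − p₂(t)` bounded on each slice `t ∈ (0, T)` (any bound; invariant
under the normalisation `pᵢ ↦ pᵢ + cᵢ(t)`), and suppose the difference `w = u₁ − u₂` obeys the
six uniform polynomial bounds `‖w‖, ‖∇w‖, ‖∇²w‖, ‖∇³w‖, ‖∂ₜw‖, ‖∇∂ₜw‖ ≤ C(1 + |x|)^{-r}` on
`[0, T] × ℝ³` for some `r > 3`. If `u₁(T) = u₂(T)` then `u₁(t) = u₂(t)` for all `t ∈ [0, T]`.
(The difference solves the linearised structure of
`linearisedNS_backward_unique_of_boundedPressure` with `U₁ = u₁`, `U₂ = u₂`, `q = p₁ − p₂`;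
compare `IsClassicalNSSolutionOn.backward_unique` — uniform rapid decay of both flows — and
`IsClassicalNSSolutionOn.backward_unique_of_decay` — `r > 4`, no pressure hypothesis.) [cite: Temam1997, Ch. III §6.2 with Lemma 6.2 (pp. 172–175)] -/
theorem IsClassicalNSSolutionOn.backward_unique_of_boundedPressure {T ν A B C r : ℝ} (hT : 0 < T)
    (hν : 0 < ν) (hA : 0 ≤ A) (hB : 0 ≤ B) (hC : 0 ≤ C) (hr : 3 < r)
    {f u₁ u₂ : ℝ → EuclideanSpace ℝ (Fin 3) → EuclideanSpace ℝ (Fin 3)}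
    {p₁ p₂ : ℝ → EuclideanSpace ℝ (Fin 3) → ℝ}
    (hs₁ : IsClassicalNSSolutionOn (Icc 0 T) ν f u₁ p₁)
    (hs₂ : IsClassicalNSSolutionOn (Icc 0 T) ν f u₂ p₂)
    (hU₁ : ∀ t ∈ Ioo 0 T, ∀ x, ‖u₁ t x‖ ≤ A) (hU₂ : ∀ t ∈ Ioo 0 T, ∀ x, ‖fderiv ℝ (u₂ t) x‖ ≤ B)
    (hpb : ∀ t ∈ Ioo 0 T, ∃ Cq : ℝ, ∀ x, ‖p₁ t x - p₂ t x‖ ≤ Cq)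
    (h0 : ∀ t ∈ Icc 0 T, ∀ x, ‖u₁ t x - u₂ t x‖ ≤ C * (1 + ‖x‖) ^ (-r))
    (h1 : ∀ t ∈ Icc 0 T, ∀ x, ‖fderiv ℝ (fun y => u₁ t y - u₂ t y) x‖ ≤ C * (1 + ‖x‖) ^ (-r))
    (h2 : ∀ t ∈ Icc 0 T, ∀ x,
      ‖fderiv ℝ (fderiv ℝ (fun y => u₁ t y - u₂ t y)) x‖ ≤ C * (1 + ‖x‖) ^ (-r))
    (h3 : ∀ t ∈ Icc 0 T, ∀ x,
      ‖iteratedFDeriv ℝ 3 (fun y => u₁ t y - u₂ t y) x‖ ≤ C * (1 + ‖x‖) ^ (-r))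
    (ht : ∀ t ∈ Icc 0 T, ∀ x,
      ‖timeDerivWithin (Icc 0 T) (fun s y => u₁ s y - u₂ s y) t x‖ ≤ C * (1 + ‖x‖) ^ (-r))
    (ht1 : ∀ t ∈ Icc 0 T, ∀ x,
      ‖fderiv ℝ (timeDerivWithin (Icc 0 T) (fun s y => u₁ s y - u₂ s y) t) x‖ ≤
        C * (1 + ‖x‖) ^ (-r))
    (hfin : u₁ T = u₂ T) : ∀ t ∈ Icc 0 T, u₁ t = u₂ t := by
  have hS : UniqueDiffOn ℝ (Icc 0 T) := uniqueDiffOn_Icc hT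
  have hsm₁ := hs₁.smooth_velocity
  have hsm₂ := hs₂.smooth_velocity
  have hw : IsSmoothSpaceTimeOn (Icc 0 T) (fun s x => u₁ s x - u₂ s x) := hsm₁.sub hsm₂
  -- slice regularity
  have hc₁ : ∀ s ∈ Icc 0 T, ContDiff ℝ 2 (u₁ s) := fun s hs =>
    contDiff_infty.1 (hs₁.contDiff_velocity hs) 2
  have hc₂ : ∀ s ∈ Icc 0 T, ContDiff ℝ 2 (u₂ s) := fun s hs =>
    contDiff_infty.1 (hs₂.contDiff_velocity hs) 2
  have hdf₁ : ∀ s ∈ Icc 0 T, Differentiable ℝ (u₁ s) := fun s hs =>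
    (hc₁ s hs).differentiable two_ne_zero
  have hdf₂ : ∀ s ∈ Icc 0 T, Differentiable ℝ (u₂ s) := fun s hs =>
    (hc₂ s hs).differentiable two_ne_zero
  have hP₁ : ∀ s ∈ Icc 0 T, ContDiff ℝ 1 (p₁ s) := fun s hs =>
    contDiff_infty.1 (hs₁.contDiff_pressure hs) 1
  have hP₂ : ∀ s ∈ Icc 0 T, ContDiff ℝ 1 (p₂ s) := fun s hs =>
    contDiff_infty.1 (hs₂.contDiff_pressure hs) 1
  -- the pressure difference, incompressibility of the difference
  have hq : ∀ s ∈ Ioo 0 T, ContDiff ℝ 1 (fun x => p₁ s x - p₂ s x) := fun s hs =>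
    (hP₁ s (Ioo_subset_Icc_self hs)).sub (hP₂ s (Ioo_subset_Icc_self hs))
  have hdiv : ∀ s ∈ Ioo 0 T, VectorCalculus.IsDivFree (fun x => u₁ s x - u₂ s x) := by
    intro s hs x
    have hsS := Ioo_subset_Icc_self hs
    have e : VectorCalculus.divergence (fun x => u₁ s x - u₂ s x) x =
        VectorCalculus.divergence (u₁ s) x - VectorCalculus.divergence (u₂ s) x := by
      simp only [VectorCalculus.divergence, fderiv_fun_sub (hdf₁ s hsS x) (hdf₂ s hsS x),
        ContinuousLinearMap.toLinearMap_sub, map_sub]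
    rw [e, hs₁.divFree s hsS x, hs₂.divFree s hsS x, sub_zero]
  -- the linearised equation for the difference
  have heq : ∀ s ∈ Ioo 0 T, ∀ x,
      timeDerivWithin (Icc 0 T) (fun s x => u₁ s x - u₂ s x) s x
        + convect (u₁ s) (fun x => u₁ s x - u₂ s x) x
        + convect (fun x => u₁ s x - u₂ s x) (u₂ s) x =
      ν • (Δ (fun x => u₁ s x - u₂ s x)) x - gradient (fun x => p₁ s x - p₂ s x) x := by
    intro s hs x
    have hsS := Ioo_subset_Icc_self hs
    have e1 := hs₁.momentum s hsS x
    have e2 := hs₂.momentum s hsS x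
    rw [convect_apply] at e1 e2
    have hwt : timeDerivWithin (Icc 0 T) (fun s x => u₁ s x - u₂ s x) s x =
        timeDerivWithin (Icc 0 T) u₁ s x - timeDerivWithin (Icc 0 T) u₂ s x :=
      ((hsm₁.hasDerivWithinAt_timeDerivWithin hS hsS x).sub
        (hsm₂.hasDerivWithinAt_timeDerivWithin hS hsS x)).derivWithin (hS s hsS)
    have hΔ : (Δ (fun x => u₁ s x - u₂ s x)) x = (Δ (u₁ s)) x - (Δ (u₂ s)) x :=
      laplacian_sub_apply_of_contDiff (hc₁ s hsS) (hc₂ s hsS) x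
    have hgq : gradient (fun x => p₁ s x - p₂ s x) x = gradient (p₁ s) x - gradient (p₂ s) x :=
      gradient_sub_apply ((hP₁ s hsS).differentiable one_ne_zero)
        ((hP₂ s hsS).differentiable one_ne_zero) x
    have hDw : fderiv ℝ (fun x => u₁ s x - u₂ s x) x = fderiv ℝ (u₁ s) x - fderiv ℝ (u₂ s) x :=
      fderiv_fun_sub (hdf₁ s hsS x) (hdf₂ s hsS x)
    rw [hwt, hΔ, hgq, convect_apply, convect_apply, hDw, FunLike.coe_sub, Pi.sub_apply,
      map_sub, smul_sub, eq_sub_of_add_eq e1, eq_sub_of_add_eq e2]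
    abel
  have hfin' : ∀ x, (fun s x => u₁ s x - u₂ s x) T x = 0 := fun x => by
    simp [hfin]
  have hqb : ∀ s ∈ Ioo 0 T, ∃ Cq : ℝ, ∀ x, ‖(fun x => p₁ s x - p₂ s x) x‖ ≤ Cq := fun s hs => by
    simpa using hpb s hs
  have hmain := linearisedNS_backward_unique_of_boundedPressure hT hν hA hB hC hr hU₁ hU₂ hw h0 h1
    h2 h3 ht ht1 hq hqb hdiv heq hfin'
  intro t ht'
  funext x
  exact sub_eq_zero.1 (hmain t ht' x)

/-- **The symmetric form: both flows bounded with bounded gradient.** Two classical solutions of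
the forced Navier–Stokes equations on `[0, T] × ℝ³` (same `ν > 0`, same force), BOTH bounded with
bounded gradient on the open slab (`‖uᵢ‖ ≤ M`, `‖∇uᵢ‖ ≤ M`), with pressure difference bounded
on each slice, whose velocity difference obeys the six uniform polynomial bounds
`≤ C(1 + |x|)^{-r}`, `r > 3`, on the closed slab, and which agree at time `T`, agree on `[0, T]`
(the case `A = B = M` of `backward_unique_of_boundedPressure`).
[cite: Temam1997, Ch. III §6.2 with Lemma 6.2 (pp. 172–175)] -/
theorem IsClassicalNSSolutionOn.backward_unique_of_boundedPressure_symm {T ν M C r : ℝ} (hT : 0 < T)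
    (hν : 0 < ν) (hM : 0 ≤ M) (hC : 0 ≤ C) (hr : 3 < r)
    {f u₁ u₂ : ℝ → EuclideanSpace ℝ (Fin 3) → EuclideanSpace ℝ (Fin 3)}
    {p₁ p₂ : ℝ → EuclideanSpace ℝ (Fin 3) → ℝ}
    (hs₁ : IsClassicalNSSolutionOn (Icc 0 T) ν f u₁ p₁)
    (hs₂ : IsClassicalNSSolutionOn (Icc 0 T) ν f u₂ p₂)
    (hb₁ : ∀ t ∈ Ioo 0 T, ∀ x, ‖u₁ t x‖ ≤ M ∧ ‖fderiv ℝ (u₁ t) x‖ ≤ M)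
    (hb₂ : ∀ t ∈ Ioo 0 T, ∀ x, ‖u₂ t x‖ ≤ M ∧ ‖fderiv ℝ (u₂ t) x‖ ≤ M)
    (hpb : ∀ t ∈ Ioo 0 T, ∃ Cq : ℝ, ∀ x, ‖p₁ t x - p₂ t x‖ ≤ Cq)
    (h0 : ∀ t ∈ Icc 0 T, ∀ x, ‖u₁ t x - u₂ t x‖ ≤ C * (1 + ‖x‖) ^ (-r))
    (h1 : ∀ t ∈ Icc 0 T, ∀ x, ‖fderiv ℝ (fun y => u₁ t y - u₂ t y) x‖ ≤ C * (1 + ‖x‖) ^ (-r))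
    (h2 : ∀ t ∈ Icc 0 T, ∀ x,
      ‖fderiv ℝ (fderiv ℝ (fun y => u₁ t y - u₂ t y)) x‖ ≤ C * (1 + ‖x‖) ^ (-r))
    (h3 : ∀ t ∈ Icc 0 T, ∀ x,
      ‖iteratedFDeriv ℝ 3 (fun y => u₁ t y - u₂ t y) x‖ ≤ C * (1 + ‖x‖) ^ (-r))
    (ht : ∀ t ∈ Icc 0 T, ∀ x,
      ‖timeDerivWithin (Icc 0 T) (fun s y => u₁ s y - u₂ s y) t x‖ ≤ C * (1 + ‖x‖) ^ (-r))
    (ht1 : ∀ t ∈ Icc 0 T, ∀ x,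
      ‖fderiv ℝ (timeDerivWithin (Icc 0 T) (fun s y => u₁ s y - u₂ s y) t) x‖ ≤
        C * (1 + ‖x‖) ^ (-r))
    (hfin : u₁ T = u₂ T) : ∀ t ∈ Icc 0 T, u₁ t = u₂ t :=
  hs₁.backward_unique_of_boundedPressure hT hν hM hM hC hr hs₂ (fun t ht' x => (hb₁ t ht' x).1)
    (fun t ht' x => (hb₂ t ht' x).2) hpb h0 h1 h2 h3 ht ht1 hfin

end NavierStokes

end Literature.Analysis.FluidPDE

end
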